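import Mathlib
import Summits.Ventures.PercRepro2.PrefMono
import Summits.Ventures.PercRepro2.AvoidMono

/-!
# The negative-correlation monotonicity theorem `NegCorrMono.invR_mono`
(blind cell PercRepro2, mine-c g30; `conjectures/MINE-C.md` §39.6)

Roots `a₁, a₂`, a vertex `v`, `ν = P(· | a₁ ↮ a₂)`, an edge `e = {v, y}` at `v` of weight `t`.
The two avoidance events `{v ∉ C₁}` and `{v ∉ C₂}` are negatively correlated under `ν`
(BHK06 1.4), i.e. `R := ν(v ∉ C₁ ∪ C₂) / (ν(v ∉ C₁) ν(v ∉ C₂)) ≤ 1`; this file shows that the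
correlation only strengthens with the edges at `v`: `1/R = P(N) P(Ω) / (P(Q) P(A))` is
non-decreasing in `t` (`Q = {a₁ ↮ a₂}`, `N = Q ∩ {v ∉ C₁}`, `Ω = Q ∩ {v ∉ C₂} = {a₂ ↮ {a₁, v}}`,
`A = Q ∩ {v ∉ C₁ ∪ C₂}`).  Proof: in the seven status classes of `PrefMonoClasses`, the derivative
of `1/R` at the gluing `v ~ y` is `V [Q·ba + a U c₂₁] + U [Q·bb + a V c₁₂]` and its endpoint bracket
is `Q V ba + Q U bb + Q a (c₀₁ + c₂₁)(c₀₂ + c₁₂) + (c₁₂ + c₂₁) U V c₀₀`, with `ba, bb ≥ 0` the two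
BHK06 1.4 brackets of `PrefMono.bhk_a` / `bhk_b`; along the line the masses are affine in `t`
(`OneRootDrop.prob_update_eq_pin`) and `G(t, s)·(1 − s) = (t − s)·[(1 − t)·T̃_s + (t − s)·Ẽ_s]`
with `T̃_s, Ẽ_s` the same two brackets at the instance of weight `s` (`core`).
-/

namespace Summit.Ventures.PercRepro2

namespace NegCorrMono

variable {V : Type*} {E : Type*} [Fintype V] [DecidableEq V] [Fintype E] [DecidableEq E]
  {R : Type*} [Field R] [LinearOrder R] [IsStrictOrderedRing R]

section Algebra

omit [Fintype V] [DecidableEq V] [Fintype E] [DecidableEq E] in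
/-- The derivative bracket `T̃_s` at the instance of weight `s` is non-negative (`u = 1 − s`). -/
lemma tT_nonneg (c00 c01 c02 c1n c12 c2n c21 s u ba bb : R) (h00 : 0 ≤ c00) (h01 : 0 ≤ c01)
    (h02 : 0 ≤ c02) (h1n : 0 ≤ c1n) (h12 : 0 ≤ c12) (h2n : 0 ≤ c2n) (h21 : 0 ≤ c21)
    (hs : 0 ≤ s) (hu : 0 ≤ u) (hba : 0 ≤ ba) (hbb : 0 ≤ bb) :
    0 ≤ ((c00 + u * c01 + u * c02) + (c1n + s * c01 + u * c12)) * (((c00 + u * c01 + u * c02) + (c1n + s * c01 + u * c12) + (c2n + s * c02 + u * c21)) * (ba + s * c02 * (c01 + c21)) + (c00 + u * c01 + u * c02) * ((c00 + u * c01 + u * c02) + (c2n + s * c02 + u * c21)) * c21) + ((c00 + u * c01 + u * c02) + (c2n + s * c02 + u * c21)) * (((c00 + u * c01 + u * c02) + (c1n + s * c01 + u * c12) + (c2n + s * c02 + u * c21)) * (bb + s * c01 * (c02 + c12)) + (c00 + u * c01 + u * c02) * ((c00 + u * c01 + u * c02) + (c1n + s * c01 + u * c12)) * c12) := by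
  positivity

omit [Fintype V] [DecidableEq V] [Fintype E] [DecidableEq E] in
/-- The endpoint bracket `Ẽ_s` at the instance of weight `s` is non-negative (`u = 1 − s`). -/
lemma tE_nonneg (c00 c01 c02 c1n c12 c2n c21 s u ba bb : R) (h00 : 0 ≤ c00) (h01 : 0 ≤ c01)
    (h02 : 0 ≤ c02) (h1n : 0 ≤ c1n) (h12 : 0 ≤ c12) (h2n : 0 ≤ c2n) (h21 : 0 ≤ c21)
    (hs : 0 ≤ s) (hu : 0 ≤ u) (hba : 0 ≤ ba) (hbb : 0 ≤ bb) :
    0 ≤ ((c00 + u * c01 + u * c02) + (c1n + s * c01 + u * c12) + (c2n + s * c02 + u * c21)) * ((c00 + u * c01 + u * c02) + (c1n + s * c01 + u * c12)) * (ba + s * c02 * (c01 + c21)) + ((c00 + u * c01 + u * c02) + (c1n + s * c01 + u * c12) + (c2n + s * c02 + u * c21)) * ((c00 + u * c01 + u * c02) + (c2n + s * c02 + u * c21)) * (bb + s * c01 * (c02 + c12)) + ((c00 + u * c01 + u * c02) + (c1n + s * c01 + u * c12) + (c2n + s * c02 + u * c21)) * (c00 + u * c01 + u * c02) * (c01 +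 c21) * (u * (c02 + c12)) + (c12 + c21) * ((c00 + u * c01 + u * c02) + (c2n + s * c02 + u * c21)) * ((c00 + u * c01 + u * c02) + (c1n + s * c01 + u * c12)) * c00 := by
  positivity

omit [Fintype V] [DecidableEq V] [Fintype E] [DecidableEq E] in
/-- **The algebraic core**: with the closed masses `N = c₂₁ + c₂ₙ + a`, `V = c₁ₙ + c₁₂ + a`,
`Q = N + c₁ₙ + c₁₂`, `A = a = c₀₁ + c₀₂ + c₀₀` and the glued masses `N₁ = c₀₀ + c₀₂ + c₂ₙ`,
`V₁ = c₀₀ + c₀₁ + c₁ₙ`, `Q₁ = c₀₀ + c₀₁ + c₀₂ + c₁ₙ + c₂ₙ`, `A₁ = c₀₀`, pinned affinely at `s ≤ t`,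
`N_s V_s Q_t A_t ≤ N_t V_t Q_s A_s` whenever the two BHK brackets are non-negative. -/
lemma core (c00 c01 c02 c1n c12 c2n c21 s t : R) (h00 : 0 ≤ c00) (h01 : 0 ≤ c01)
    (h02 : 0 ≤ c02) (h1n : 0 ≤ c1n) (h12 : 0 ≤ c12) (h2n : 0 ≤ c2n) (h21 : 0 ≤ c21)
    (hs : 0 ≤ s) (hst : s ≤ t) (ht : t ≤ 1)
    (hba : 0 ≤ (c2n + c21) * c01 - (c01 + c02 + c00) * c21)
    (hbb : 0 ≤ (c1n + c12) * c02 - (c01 + c02 + c00) * c12) :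
    (s * (c00 + c02 + c2n) + (1 - s) * (c21 + c2n + (c01 + c02 + c00))) * (s * (c00 + c01 + c1n) + (1 - s) * (c1n + c12 + (c01 + c02 + c00))) * ((t * (c00 + c01 + c02 + c1n + c2n) + (1 - t) * (c1n + c12 + (c21 + c2n + (c01 + c02 + c00)))) * (t * c00 + (1 - t) * (c01 + c02 + c00))) ≤
      (t * (c00 + c02 + c2n) + (1 - t) * (c21 + c2n + (c01 + c02 + c00))) * (t * (c00 + c01 + c1n) + (1 - t) * (c1n + c12 + (c01 + c02 + c00))) * ((s * (c00 + c01 + c02 + c1n + c2n) + (1 - s) * (c1n + c12 + (c21 + c2n + (c01 + c02 + c00)))) * (s * c00 + (1 - s) * (c01 + c02 + c00))) := by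
  have hs1 : 0 ≤ 1 - s := by linarith
  have ht1 : 0 ≤ 1 - t := by linarith
  have hts : 0 ≤ t - s := by linarith
  have hT := tT_nonneg (R := R) c00 c01 c02 c1n c12 c2n c21 s (1 - s)
    ((c2n + c21) * c01 - (c01 + c02 + c00) * c21) ((c1n + c12) * c02 - (c01 + c02 + c00) * c12)
    h00 h01 h02 h1n h12 h2n h21 hs hs1 hba hbb
  have hE := tE_nonneg (R := R) c00 c01 c02 c1n c12 c2n c21 s (1 - s)
    ((c2n + c21) * c01 - (c01 + c02 + c00) * c21) ((c1n + c12) * c02 - (c01 + c02 + c00) * c12)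
    h00 h01 h02 h1n h12 h2n h21 hs hs1 hba hbb
  have hprod : 0 ≤ (t - s) * ((1 - t) * (((c00 + (1 - s) * c01 + (1 - s) * c02) + (c1n + s * c01 + (1 - s) * c12)) * (((c00 + (1 - s) * c01 + (1 - s) * c02) + (c1n + s * c01 + (1 - s) * c12) + (c2n + s * c02 + (1 - s) * c21)) * ((c2n + c21) * c01 - (c01 + c02 + c00) * c21 + s * c02 * (c01 + c21)) + (c00 + (1 - s) * c01 + (1 - s) * c02) * ((c00 + (1 - s) * c01 + (1 - s) * c02) + (c2n + s * c02 + (1 - s) * c21)) * c21) + ((c00 + (1 - s) * c01 + (1 - s) * c02) + (c2n + s * c02 + (1 - s) * c21)) * (((c00 + (1 - s) * c01 + (1 - s) * c02) + (c1n + s * c01 + (1 - s) * c12) + (c2n + s * c02 + (1 - s) * c21)) * ((c1n + c12) * c02 - (c01 + c02 + c00) * c12 + s * c01 * (c02 + c12)) + (c00 + (1 - s) * c01 + (1 - s) * c02) * ((c00 + (1 - s) * c01 + (1 - s) * c02) + (c1n + s * c01 + (1 - s) * c12)) * c12)) + (t - s) * (((c00 + (1 - s) * c01 + (1 - s) * c02)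 + (c1n + s * c01 + (1 - s) * c12) + (c2n + s * c02 + (1 - s) * c21)) * ((c00 + (1 - s) * c01 + (1 - s) * c02) + (c1n + s * c01 + (1 - s) * c12)) * ((c2n + c21) * c01 - (c01 + c02 + c00) * c21 + s * c02 * (c01 + c21)) + ((c00 + (1 - s) * c01 + (1 - s) * c02) + (c1n + s * c01 + (1 - s) * c12) + (c2n + s * c02 + (1 - s) * c21)) * ((c00 + (1 - s) * c01 + (1 - s) * c02) + (c2n + s * c02 + (1 - s) * c21)) * ((c1n + c12) * c02 - (c01 + c02 + c00) * c12 + s * c01 * (c02 + c12)) + ((c00 + (1 - s) * c01 + (1 - s) * c02) + (c1n + s * c01 + (1 - s) * c12) + (c2n + s * c02 + (1 - s) * c21)) * (c00 + (1 - s) * c01 + (1 - s) * c02) * (c01 + c21) * ((1 - s) * (c02 + c12)) + (c12 + c21) * ((c00 + (1 - s) * c01 + (1 - s) * c02) + (c2n + s * c02 + (1 - s) * c21)) * ((c00 + (1 - s) * c01 + (1 - s) * c02) + (c1n + s * c01 + (1 - s) * c12)) * c00)) :=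
    mul_nonneg hts (add_nonneg (mul_nonneg ht1 hT) (mul_nonneg hts hE))
  have key : ((t * (c00 + c02 + c2n) + (1 - t) * (c21 + c2n + (c01 + c02 + c00))) * (t * (c00 + c01 + c1n) + (1 - t) * (c1n + c12 + (c01 + c02 + c00))) * ((s * (c00 + c01 + c02 + c1n + c2n) + (1 - s) * (c1n + c12 + (c21 + c2n + (c01 + c02 + c00)))) * (s * c00 + (1 - s) * (c01 + c02 + c00))) -
      (s * (c00 + c02 + c2n) + (1 - s) * (c21 + c2n + (c01 + c02 + c00))) * (s * (c00 + c01 + c1n) + (1 - s) * (c1n + c12 + (c01 + c02 + c00))) * ((t * (c00 + c01 + c02 + c1n + c2n) + (1 - t) * (c1n + c12 + (c21 + c2n + (c01 + c02 + c00)))) * (t * c00 + (1 - t) * (c01 + c02 + c00)))) * (1 - s) =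
      (t - s) * ((1 - t) * (((c00 + (1 - s) * c01 + (1 - s) * c02) + (c1n + s * c01 + (1 - s) * c12)) * (((c00 + (1 - s) * c01 + (1 - s) * c02) + (c1n + s * c01 + (1 - s) * c12) + (c2n + s * c02 + (1 - s) * c21)) * ((c2n + c21) * c01 - (c01 + c02 + c00) * c21 + s * c02 * (c01 + c21)) + (c00 + (1 - s) * c01 + (1 - s) * c02) * ((c00 + (1 - s) * c01 + (1 - s) * c02) + (c2n + s * c02 + (1 - s) * c21)) * c21) + ((c00 + (1 - s) * c01 + (1 - s) * c02) + (c2n + s * c02 + (1 - s) * c21)) * (((c00 + (1 - s) * c01 + (1 - s) * c02) + (c1n + s * c01 + (1 - s) * c12) + (c2n + s * c02 + (1 - s) * c21)) * ((c1n + c12) * c02 - (c01 + c02 + c00) * c12 + s * c01 * (c02 + c12)) + (c00 + (1 - s) * c01 + (1 - s) * c02) * ((c00 + (1 - s) * c01 + (1 - s) * c02) + (c1n + s * c01 + (1 - s) * c12)) * c12)) + (t - s) * (((c00 + (1 - s) * c01 + (1 - s) * c02) + (c1n + s * c01 + (1 - s) * c12) + (c2n + s * c02 + (1 - s) * c21))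 * ((c00 + (1 - s) * c01 + (1 - s) * c02) + (c1n + s * c01 + (1 - s) * c12)) * ((c2n + c21) * c01 - (c01 + c02 + c00) * c21 + s * c02 * (c01 + c21)) + ((c00 + (1 - s) * c01 + (1 - s) * c02) + (c1n + s * c01 + (1 - s) * c12) + (c2n + s * c02 + (1 - s) * c21)) * ((c00 + (1 - s) * c01 + (1 - s) * c02) + (c2n + s * c02 + (1 - s) * c21)) * ((c1n + c12) * c02 - (c01 + c02 + c00) * c12 + s * c01 * (c02 + c12)) + ((c00 + (1 - s) * c01 + (1 - s) * c02) + (c1n + s * c01 + (1 - s) * c12) + (c2n + s * c02 + (1 - s) * c21)) * (c00 + (1 - s) * c01 + (1 - s) * c02) * (c01 + c21) * ((1 - s) * (c02 + c12)) + (c12 + c21) * ((c00 + (1 - s) * c01 + (1 - s) * c02) + (c2n + s * c02 + (1 - s) * c21)) * ((c00 + (1 - s) * c01 + (1 - s) * c02) + (c1n + s * c01 + (1 - s) * c12)) * c00)) := by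
    ring
  rcases lt_or_eq_of_le (le_trans hst ht) with hs1' | hs1'
  · have hpos : 0 < 1 - s := by linarith
    have hG : 0 ≤ ((t * (c00 + c02 + c2n) + (1 - t) * (c21 + c2n + (c01 + c02 + c00))) * (t * (c00 + c01 + c1n) + (1 - t) * (c1n + c12 + (c01 + c02 + c00))) * ((s * (c00 + c01 + c02 + c1n + c2n) + (1 - s) * (c1n + c12 + (c21 + c2n + (c01 + c02 + c00)))) * (s * c00 + (1 - s) * (c01 + c02 + c00))) -
        (s * (c00 + c02 + c2n) + (1 - s) * (c21 + c2n + (c01 + c02 + c00))) * (s * (c00 + c01 + c1n) + (1 - s) * (c1n + c12 + (c01 + c02 + c00))) * ((t * (c00 + c01 + c02 + c1n + c2n) + (1 - t) * (c1n + c12 + (c21 + c2n + (c01 + c02 + c00)))) * (t * c00 + (1 - t) * (c01 + c02 + c00)))) * (1 - s) := by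
      rw [key]; exact hprod
    have := nonneg_of_mul_nonneg_left hG hpos
    linarith
  · subst hs1'
    have ht' : t = 1 := le_antisymm ht hst
    subst ht'
    exact le_refl _

end Algebra

section Masses

open PrefMono

variable (p : E → R) (ends : E → Sym2 V) (a₁ a₂ : V) {e : E} {v y : V}

omit [Fintype V] [Fintype E] [DecidableEq E] in
/-- Membership in `Ω = {a₂ ↮ {a₁, v}}`: `Q` and `v ∉ C₂`. -/
lemma mem_Omega_iff {ω : Config E} (v : V) :
    ω ∈ avoidAll ends a₂ {a₁, v} ↔ ω ∈ PrefMono.QEvent ends a₁ a₂ ∧ ¬ Conn ends ω a₂ v := by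
  rw [mem_avoidAll]
  simp only [Finset.mem_insert, Finset.mem_singleton, forall_eq_or_imp, forall_eq]
  constructor
  · rintro ⟨h1, h2⟩
    refine ⟨?_, h2⟩
    rw [show PrefMono.QEvent ends a₁ a₂ = avoidAll ends a₁ {a₂} from rfl, mem_avoid_single_iff]
    exact fun h => h1 (conn_symm h)
  · rintro ⟨h1, h2⟩
    rw [show PrefMono.QEvent ends a₁ a₂ = avoidAll ends a₁ {a₂} from rfl, mem_avoid_single_iff] at h1
    exact ⟨fun h => h1 (conn_symm h), h2⟩

omit [Fintype V] [LinearOrder R] [IsStrictOrderedRing R] in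
/-- `P(Ω) = P(E) + P(A)` (split `Ω` by `v ∈ C₁`). -/
lemma Omega_eq (v : V) : prob p (avoidAll ends a₂ {a₁, v}) =
    prob p (EEvent ends a₁ a₂ v) + prob p (AEvent ends a₁ a₂ v) := by
  have h1 : avoidAll ends a₂ {a₁, v} ∩ connEvent ends a₁ v = EEvent ends a₁ a₂ v := by
    ext ω
    rw [Set.mem_inter_iff, mem_Omega_iff, mem_connEvent, mem_E_iff]
    constructor
    · rintro ⟨⟨hQ, _⟩, h⟩; exact ⟨hQ, h⟩
    · rintro ⟨hQ, h⟩; exact ⟨⟨hQ, not_conn₂_of_conn₁ hQ h⟩, h⟩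
  have h2 : avoidAll ends a₂ {a₁, v} ∩ (connEvent ends a₁ v)ᶜ = AEvent ends a₁ a₂ v := by
    ext ω
    rw [Set.mem_inter_iff, Set.mem_compl_iff, mem_Omega_iff, mem_connEvent, mem_A_iff]
    constructor
    · rintro ⟨⟨hQ, h2⟩, h1⟩; exact ⟨hQ, h1, h2⟩
    · rintro ⟨hQ, h1, h2⟩; exact ⟨⟨hQ, h2⟩, h1⟩
  rw [split p (avoidAll ends a₂ {a₁, v}) (connEvent ends a₁ v), h1, h2]

omit [Fintype V] [LinearOrder R] [IsStrictOrderedRing R] in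
/-- `P₁(Ω) = c₀₀ + c₀₁ + c₁ₙ`: after the gluing `v ∉ C₂` iff neither `v` nor `y` was in `C₂`. -/
lemma Omega_one (hends : ends e = s(v, y)) :
    prob (Function.update p e 1) (avoidAll ends a₂ {a₁, v}) =
      prob (Function.update p e 0) (Z00 ends a₁ a₂ v y) +
      prob (Function.update p e 0) (Z01 ends a₁ a₂ v y) +
      prob (Function.update p e 0) (Z1n ends a₁ a₂ v y) := by
  rw [AvoidMono.prob_one_avoidAll p hends a₂
    (Finset.mem_insert_of_mem (Finset.mem_singleton_self v))]
  have h1 : avoidAll ends a₂ {a₁, v} ∩ avoidAll ends a₂ {y} ∩ connEvent ends a₁ v =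
      Z1n ends a₁ a₂ v y := by
    ext ω
    rw [Set.mem_inter_iff, Set.mem_inter_iff, mem_Omega_iff, mem_avoid_single_iff, mem_connEvent,
      mem_Z1n]
    constructor
    · rintro ⟨⟨⟨hQ, _⟩, hy⟩, hv⟩; exact ⟨hQ, hv, hy⟩
    · rintro ⟨hQ, hv, hy⟩; exact ⟨⟨⟨hQ, not_conn₂_of_conn₁ hQ hv⟩, hy⟩, hv⟩
  have h2 : avoidAll ends a₂ {a₁, v} ∩ avoidAll ends a₂ {y} ∩ (connEvent ends a₁ v)ᶜ ∩
      connEvent ends a₁ y = Z01 ends a₁ a₂ v y := by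
    ext ω
    rw [Set.mem_inter_iff, Set.mem_inter_iff, Set.mem_inter_iff, Set.mem_compl_iff, mem_Omega_iff,
      mem_avoid_single_iff, mem_connEvent, mem_connEvent, mem_Z01]
    constructor
    · rintro ⟨⟨⟨⟨hQ, hv2⟩, _⟩, hv1⟩, hy⟩; exact ⟨hQ, hv1, hv2, hy⟩
    · rintro ⟨hQ, hv1, hv2, hy⟩; exact ⟨⟨⟨⟨hQ, hv2⟩, not_conn₂_of_conn₁ hQ hy⟩, hv1⟩, hy⟩
  have h3 : avoidAll ends a₂ {a₁, v} ∩ avoidAll ends a₂ {y} ∩ (connEvent ends a₁ v)ᶜ ∩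
      (connEvent ends a₁ y)ᶜ = Z00 ends a₁ a₂ v y := by
    ext ω
    rw [Set.mem_inter_iff, Set.mem_inter_iff, Set.mem_inter_iff, Set.mem_compl_iff,
      Set.mem_compl_iff, mem_Omega_iff, mem_avoid_single_iff, mem_connEvent, mem_connEvent, mem_Z00]
    constructor
    · rintro ⟨⟨⟨⟨hQ, hv2⟩, hy2⟩, hv1⟩, hy1⟩; exact ⟨hQ, hv1, hv2, hy1, hy2⟩
    · rintro ⟨hQ, hv1, hv2, hy1, hy2⟩; exact ⟨⟨⟨⟨hQ, hv2⟩, hy2⟩, hv1⟩, hy1⟩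
  rw [split (Function.update p e 0) (avoidAll ends a₂ {a₁, v} ∩ avoidAll ends a₂ {y})
    (connEvent ends a₁ v), h1,
    split (Function.update p e 0) (avoidAll ends a₂ {a₁, v} ∩ avoidAll ends a₂ {y} ∩
      (connEvent ends a₁ v)ᶜ) (connEvent ends a₁ y), h2, h3]
  ring

end Masses

section Main

open PrefMono

variable (p : E → R) (ends : E → Sym2 V) {e : E} {v y : V}

/-- **The negative-correlation monotonicity theorem**: `1/R = P_t(N) P_t(Ω) / (P_t(Q) P_t(A))
= ν_t(v∉C₁) ν_t(v∉C₂) / ν_t(v∉U)` (`N = {v ∉ C₁}`, `Ω = {v ∉ C₂}`, `A = {v ∉ C₁ ∪ C₂}`, all under `Q`)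
is non-decreasing in the weight `t ∈ [0, 1]` of an edge `e = {v, y}` at `v`, wherever `P_t(A) > 0`
(equivalently `R = ν(v∉U)/(ν(v∉C₁) ν(v∉C₂))` is non-increasing: the negative correlation of the two
avoidance events strengthens with every edge at `v`). -/
theorem invR_mono (hp : IsProbVec p) (hends : ends e = s(v, y)) (a₁ a₂ : V) {s t : R}
    (hs : 0 ≤ s) (hst : s ≤ t) (ht : t ≤ 1)
    (hAs : 0 < prob (Function.update p e s) (AEvent ends a₁ a₂ v))
    (hAt : 0 < prob (Function.update p e t) (AEvent ends a₁ a₂ v)) :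
    prob (Function.update p e s) (TwoRootLean.NEvent ends a₁ a₂ v) *
        prob (Function.update p e s) (avoidAll ends a₂ {a₁, v}) /
        (prob (Function.update p e s) (PrefMono.QEvent ends a₁ a₂) *
          prob (Function.update p e s) (AEvent ends a₁ a₂ v)) ≤
      prob (Function.update p e t) (TwoRootLean.NEvent ends a₁ a₂ v) *
        prob (Function.update p e t) (avoidAll ends a₂ {a₁, v}) /
        (prob (Function.update p e t) (PrefMono.QEvent ends a₁ a₂) *
          prob (Function.update p e t) (AEvent ends a₁ a₂ v)) := by
  have hp₀ : IsProbVec (Function.update p e 0) := hp.update e le_rfl zero_le_one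
  have hps : IsProbVec (Function.update p e s) := hp.update e hs (le_trans hst ht)
  have hpt : IsProbVec (Function.update p e t) := hp.update e (le_trans hs hst) ht
  have hQs : 0 < prob (Function.update p e s) (PrefMono.QEvent ends a₁ a₂) :=
    lt_of_lt_of_le hAs (prob_mono hps fun ω hω => (mem_A_iff.1 hω).1)
  have hQt : 0 < prob (Function.update p e t) (PrefMono.QEvent ends a₁ a₂) :=
    lt_of_lt_of_le hAt (prob_mono hpt fun ω hω => (mem_A_iff.1 hω).1)
  rw [div_le_div_iff₀ (mul_pos hQs hAs) (mul_pos hQt hAt)]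
  have h00 : 0 ≤ prob (Function.update p e 0) (Z00 ends a₁ a₂ v y) := prob_nonneg hp₀ _
  have h01 : 0 ≤ prob (Function.update p e 0) (Z01 ends a₁ a₂ v y) := prob_nonneg hp₀ _
  have h02 : 0 ≤ prob (Function.update p e 0) (Z02 ends a₁ a₂ v y) := prob_nonneg hp₀ _
  have h1n : 0 ≤ prob (Function.update p e 0) (Z1n ends a₁ a₂ v y) := prob_nonneg hp₀ _
  have h12 : 0 ≤ prob (Function.update p e 0) (Z12 ends a₁ a₂ v y) := prob_nonneg hp₀ _
  have h2n : 0 ≤ prob (Function.update p e 0) (Z2n ends a₁ a₂ v y) := prob_nonneg hp₀ _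
  have h21 : 0 ≤ prob (Function.update p e 0) (Z21 ends a₁ a₂ v y) := prob_nonneg hp₀ _
  have hE0 := E_eq (Function.update p e 0) ends a₁ a₂ v y
  have hA0 := A_eq (Function.update p e 0) ends a₁ a₂ v y
  have hN0 : prob (Function.update p e 0) (TwoRootLean.NEvent ends a₁ a₂ v) =
      prob (Function.update p e 0) (Z21 ends a₁ a₂ v y) +
        prob (Function.update p e 0) (Z2n ends a₁ a₂ v y) +
        (prob (Function.update p e 0) (Z01 ends a₁ a₂ v y) +
          prob (Function.update p e 0) (Z02 ends a₁ a₂ v y) +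
          prob (Function.update p e 0) (Z00 ends a₁ a₂ v y)) := by
    rw [N_eq_M2_add_A (Function.update p e 0) ends a₁ a₂ v,
      M2_eq (Function.update p e 0) ends a₁ a₂ v y, hA0]
  have hQ0 : prob (Function.update p e 0) (PrefMono.QEvent ends a₁ a₂) =
      prob (Function.update p e 0) (Z1n ends a₁ a₂ v y) +
        prob (Function.update p e 0) (Z12 ends a₁ a₂ v y) +
        (prob (Function.update p e 0) (Z21 ends a₁ a₂ v y) +
          prob (Function.update p e 0) (Z2n ends a₁ a₂ v y) +
          (prob (Function.update p e 0) (Z01 ends a₁ a₂ v y) +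
            prob (Function.update p e 0) (Z02 ends a₁ a₂ v y) +
            prob (Function.update p e 0) (Z00 ends a₁ a₂ v y))) := by
    rw [Q_eq_E_add_N (Function.update p e 0) ends a₁ a₂ v, hE0, hN0]
  have hV0 : prob (Function.update p e 0) (avoidAll ends a₂ {a₁, v}) =
      prob (Function.update p e 0) (Z1n ends a₁ a₂ v y) +
        prob (Function.update p e 0) (Z12 ends a₁ a₂ v y) +
        (prob (Function.update p e 0) (Z01 ends a₁ a₂ v y) +
          prob (Function.update p e 0) (Z02 ends a₁ a₂ v y) +
          prob (Function.update p e 0) (Z00 ends a₁ a₂ v y)) := by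
    rw [Omega_eq (Function.update p e 0) ends a₁ a₂ v, hE0, hA0]
  have hN1 := N_one p ends a₁ a₂ hends
  have hQ1 := Q_one p ends a₁ a₂ hends
  have hA1 := A_one p ends a₁ a₂ hends
  have hV1 := Omega_one p ends a₁ a₂ hends
  have hba : 0 ≤ (prob (Function.update p e 0) (Z2n ends a₁ a₂ v y) +
      prob (Function.update p e 0) (Z21 ends a₁ a₂ v y)) *
        prob (Function.update p e 0) (Z01 ends a₁ a₂ v y) -
      (prob (Function.update p e 0) (Z01 ends a₁ a₂ v y) +
        prob (Function.update p e 0) (Z02 ends a₁ a₂ v y) +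
        prob (Function.update p e 0) (Z00 ends a₁ a₂ v y)) *
        prob (Function.update p e 0) (Z21 ends a₁ a₂ v y) := by
    have := bhk_a (Function.update p e 0) ends a₁ a₂ v y hp₀
    rw [hN0] at this
    linarith [this]
  have hbb : 0 ≤ (prob (Function.update p e 0) (Z1n ends a₁ a₂ v y) +
      prob (Function.update p e 0) (Z12 ends a₁ a₂ v y)) *
        prob (Function.update p e 0) (Z02 ends a₁ a₂ v y) -
      (prob (Function.update p e 0) (Z01 ends a₁ a₂ v y) +
        prob (Function.update p e 0) (Z02 ends a₁ a₂ v y) +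
        prob (Function.update p e 0) (Z00 ends a₁ a₂ v y)) *
        prob (Function.update p e 0) (Z12 ends a₁ a₂ v y) := by
    have := bhk_b (Function.update p e 0) ends a₁ a₂ v y hp₀
    rw [hE0, hA0] at this
    linarith [this]
  rw [OneRootDrop.prob_update_eq_pin p s (TwoRootLean.NEvent ends a₁ a₂ v),
    OneRootDrop.prob_update_eq_pin p s (avoidAll ends a₂ {a₁, v}),
    OneRootDrop.prob_update_eq_pin p s (PrefMono.QEvent ends a₁ a₂),
    OneRootDrop.prob_update_eq_pin p s (AEvent ends a₁ a₂ v),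
    OneRootDrop.prob_update_eq_pin p t (TwoRootLean.NEvent ends a₁ a₂ v),
    OneRootDrop.prob_update_eq_pin p t (avoidAll ends a₂ {a₁, v}),
    OneRootDrop.prob_update_eq_pin p t (PrefMono.QEvent ends a₁ a₂),
    OneRootDrop.prob_update_eq_pin p t (AEvent ends a₁ a₂ v), hN0, hV0, hQ0, hA0, hN1, hV1, hQ1,
    hA1]
  exact core _ _ _ _ _ _ _ s t h00 h01 h02 h1n h12 h2n h21 hs hst ht hba hbb

end Main

end NegCorrMono

end Summit.Ventures.PercRepro2
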